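import Summits.ABC.Harvest.OpenQuestionsGlue
import Summits.ABC.Analytic.PolySzpiro
import Literature.NumberTheory.DiophantineGeometry.AbcValuationProductFreyDataProofs
import HarnessLib

/-!
# ABC harvest 2015–2026: glue BY NAME to the rung decl `Summit.ABC.PolySzpiroRat` (glue, part 3)

`Summits/ABC/Harvest/OpenQuestionsGlueAPS.lean` — cell `abc-harv` (seat typ-1), namespace `Summit.ABC.Harvest`.
Third SORRY-FREE glue file for `OpenQuestions.lean`, written once the sub-summit rung A-PS had its ONE tree
declaration `Summit.ABC.PolySzpiroRat := ∃ K C, Summit.ABC.PolySzpiroRatEff K C`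
(`Summits/ABC/Analytic/PolySzpiro.lean`, abc-an cell; director-abc 2026-08-27 «one Prop, not three»). The
A-PS-directed theorems of parts 1–2 carry the sentence `∃ K C, ∀ E/ℚ, log|Δ_min| ≤ K log N + C` spelled out;
here they are repackaged BY NAME (definitional one-liners), and the one substantive arrow the referee asked
for is landed:

* `polySzpiroRat_of_heightConjecture : HeightConjecture → Summit.ABC.PolySzpiroRat` (≥A-PS door H-022, PROVED;
  content = Silverman–Pasten `log|Δ_min| < 12 h_F + 16`, also abc-an's `polySzpiroRat_of_polyFaltingsHeight`);
* `subexponentialSzpiro_of_polySzpiroRat`, `szpiroExponentBelowOne_of_polySzpiroRat`, `moretBaillyCD_of_polySzpiroRat`,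
  `szpiroLogLogShape_of_polySzpiroRatEff` — A-PS sits ABOVE every record rung of §1/§5/§7 (PROVED);
* `pastenWeakABC_of_polySzpiroRat : Summit.ABC.PolySzpiroRat → PastenWeakABC` — **A-PS ⟹ Pasten's Conj. 1.2
  (poly-abc)**, PROVED via the Frey–Hellegouarch curve on the tree-PROVED Frey facts of
  `AbcValuationProductFreyDataProofs` (proof by the cell's referee abc-harv-ref-2, landed here); the converse
  is NOT known (REF-B P-6).

HONESTY LINE: abc is not proved by any of this; A-PS is NOT abc — «NOT abc — POLY-SZPIRO(E)»; typed ≠ proved.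
No `sorry`, no axiom, no new definition.
-/

noncomputable section

namespace Summit.ABC.Harvest

open Literature.NumberTheory.EllipticCurves
open Literature.NumberTheory.DiophantineGeometry

/-! ## By-name repackaging of parts 1–2 -/

/-- **≥A-PS door H-022 BY NAME (PROVED): `HeightConjecture → Summit.ABC.PolySzpiroRat`**
(`exists_log_minimalDiscriminant_le_of_heightConjecture`, definitional repackaging). «NOT abc — POLY-SZPIRO(12K)».
[cite: PastenShimura2024, §3 p. 13 (log Δ_E ≤ 12 h(E) + 16)] -/
theorem polySzpiroRat_of_heightConjecture (h : HeightConjecture) : Summit.ABC.PolySzpiroRat := by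
  obtain ⟨K, C, hKC⟩ := exists_log_minimalDiscriminant_le_of_heightConjecture h
  exact ⟨K, C, fun W _ => hKC W⟩

/-- The A-PS decl unfolds to the spelled-out sentence used in parts 1–2. [folklore] -/
theorem exists_linear_of_polySzpiroRat (h : Summit.ABC.PolySzpiroRat) :
    ∃ K C : ℝ, ∀ (W : WeierstrassCurve ℚ) [W.IsElliptic],
      Real.log (W.minimalDiscriminantNorm ℤ : ℝ) ≤ K * Real.log (W.conductorNorm ℤ : ℝ) + C := by
  obtain ⟨K, C, hKC⟩ := h
  exact ⟨K, C, fun W _ => hKC W⟩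

/-- **A-PS ⟹ sub-exponential Szpiro, BY NAME** (PROVED). [folklore] -/
theorem subexponentialSzpiro_of_polySzpiroRat (h : Summit.ABC.PolySzpiroRat) : SubexponentialSzpiro :=
  subexponentialSzpiro_of_linear (exists_linear_of_polySzpiroRat h)

/-- **A-PS ⟹ some exponent `α < 1`, BY NAME** (PROVED). [folklore] -/
theorem szpiroExponentBelowOne_of_polySzpiroRat (h : Summit.ABC.PolySzpiroRat) : SzpiroExponentBelowOne :=
  szpiroExponentBelowOne_of_subexponential (subexponentialSzpiro_of_polySzpiroRat h)

/-- **A-PS ⟹ Moret-Bailly's Hypothèse CD (its semistable half), BY NAME** (PROVED). [folklore] -/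
theorem moretBaillyCD_of_polySzpiroRat (h : Summit.ABC.PolySzpiroRat) : MoretBaillyCD :=
  moretBaillyCD_of_linear (exists_linear_of_polySzpiroRat h)

/-- **A-PS-eff with `K ≥ 0` ⟹ Pasten's log·loglog yardstick with the same `K`, BY NAME** (PROVED). [folklore] -/
theorem szpiroLogLogShape_of_polySzpiroRatEff {K C : ℝ} (hK : 0 ≤ K) (h : Summit.ABC.PolySzpiroRatEff K C) :
    SzpiroLogLogShape K :=
  szpiroLogLogShape_of_linear (C := C) hK (fun W _ => h W)

/-! ## A-PS ⟹ Pasten's Conjecture 1.2 through the Frey–Hellegouarch curve (referee abc-harv-ref-2's proof) -/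

/-- For an abc triple and an odd `n ∣ abc`: `n² ∣ |Δ_min|` of the Frey–Hellegouarch curve `E_{a,b}` (from the
tree-PROVED `IsABCTriple.factorization_minimalDiscriminantNorm_freyCurve`; referee abc-harv-ref-2's lemma). [folklore] -/
theorem sq_dvd_minimalDiscriminantNorm_freyCurve {a b c : ℕ} (h : IsABCTriple a b c)
    {n : ℕ} (hn : n ∣ a * b * c) (hodd : ¬ 2 ∣ n) :
    n ^ 2 ∣ (freyCurve (a : ℤ) (b : ℤ)).minimalDiscriminantNorm ℤ := by
  have hD : (freyCurve (a : ℤ) (b : ℤ)).minimalDiscriminantNorm ℤ ≠ 0 :=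
    (WeierstrassCurve.minimalDiscriminantNorm_pos_holds _).ne'
  have hn0 : n ≠ 0 := by rintro rfl; exact hodd (dvd_zero 2)
  rw [← Nat.factorization_le_iff_dvd (pow_ne_zero 2 hn0) hD]
  intro q
  rw [Nat.factorization_pow, Finsupp.smul_apply, smul_eq_mul]
  by_cases hq : q.Prime
  · by_cases hq2 : q = 2
    · subst hq2
      rw [Nat.factorization_eq_zero_of_not_dvd hodd, mul_zero]
      exact Nat.zero_le _
    · rw [h.factorization_minimalDiscriminantNorm_freyCurve hq hq2]
      exact Nat.mul_le_mul_left 2 ((Nat.factorization_le_iff_dvd hn0 h.mul_ne_zero).mpr hn q)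
  · rw [Nat.factorization_eq_zero_of_not_prime _ hq, mul_zero]
    exact Nat.zero_le _

/-- For an abc triple there is an odd `n ∣ abc` with `abc ≤ 2 n²` (the product of the two odd members;
referee abc-harv-ref-2's lemma). [folklore] -/
theorem exists_odd_dvd_le {a b c : ℕ} (h : IsABCTriple a b c) :
    ∃ n : ℕ, n ∣ a * b * c ∧ ¬ 2 ∣ n ∧ a * b * c ≤ 2 * n ^ 2 := by
  obtain ⟨ha, hb, habc, hcop⟩ := h
  have hodd_mul : ∀ {x y : ℕ}, ¬ 2 ∣ x → ¬ 2 ∣ y → ¬ 2 ∣ x * y :=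
    fun hx hy hxy => (Nat.prime_two.dvd_mul.mp hxy).elim hx hy
  by_cases h2a : 2 ∣ a
  · -- `a` even ⇒ `b`, `c` odd; take `n = b c`
    have h2b : ¬ 2 ∣ b := fun hb2 => by
      have := Nat.dvd_gcd h2a hb2
      rw [hcop] at this
      exact absurd this (by norm_num)
    have h2c : ¬ 2 ∣ c := fun hc2 => by
      have : 2 ∣ c - a := Nat.dvd_sub hc2 h2a
      rw [show c - a = b by omega] at this
      exact h2b this
    refine ⟨b * c, ⟨a, by ring⟩, hodd_mul h2b h2c, ?_⟩
    calc a * b * c ≤ c * b * c := by gcongr; omega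
      _ = 1 * (b * (c * c)) := by ring
      _ ≤ (2 * b) * (b * (c * c)) := Nat.mul_le_mul_right _ (by omega)
      _ = 2 * (b * c) ^ 2 := by ring
  · by_cases h2b : 2 ∣ b
    · -- `b` even ⇒ `a`, `c` odd; take `n = a c`
      have h2c : ¬ 2 ∣ c := fun hc2 => by
        have : 2 ∣ c - b := Nat.dvd_sub hc2 h2b
        rw [show c - b = a by omega] at this
        exact h2a this
      refine ⟨a * c, ⟨b, by ring⟩, hodd_mul h2a h2c, ?_⟩
      calc a * b * c ≤ a * c * c := by gcongr; omega
        _ = 1 * (a * (c * c)) := by ring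
        _ ≤ (2 * a) * (a * (c * c)) := Nat.mul_le_mul_right _ (by omega)
        _ = 2 * (a * c) ^ 2 := by ring
    · -- `a`, `b` odd; take `n = a b`
      refine ⟨a * b, ⟨c, rfl⟩, hodd_mul h2a h2b, ?_⟩
      have hc : c ≤ 2 * (a * b) := by
        have h1 : a ≤ a * b := Nat.le_mul_of_pos_right a hb
        have h2 : b ≤ a * b := Nat.le_mul_of_pos_left b ha
        omega
      calc a * b * c ≤ a * b * (2 * (a * b)) := Nat.mul_le_mul_left _ hc
        _ = 2 * (a * b) ^ 2 := by ring

/-- **GLUE (PROVED): rung A-PS ⟹ Pasten's Conj. 1.2** («it is clear that Conjecture 1.1 implies Conjecture 1.2»,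
Pasten JNT 254 §3 p. 13), BY NAME from `Summit.ABC.PolySzpiroRat`: for an abc triple, the Frey–Hellegouarch curve
`E_{a,b}` has `abc ≤ 2·|Δ_min(E)|` (odd part: `v_q(Δ_min) = 2 v_q(abc)` at odd `q`, tree-PROVED
`IsABCTriple.factorization_minimalDiscriminantNorm_freyCurve`) and `N_E ≤ 2⁸ rad(abc)` (tree-PROVED
`IsABCTriple.conductorNorm_freyCurve_le`), so `abc ≤ 2 e^C (2⁸ rad)^{K⁺} < rad^{K⁺ + L}`. Proof written by the
cell's referee abc-harv-ref-2 (scratch `lanes/ref-2/Glue_APS_to_PastenWeakABC.tree.lean`, 2026-08-27), landed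
here verbatim up to names (D-0016: provers land). So H-019's row reads «A-PS ⟹ Conj. 1.2 PROVED; converse NOT
known (REF-B P-6)». [cite: PastenShimura2024, §3 p. 13 (Conj. 1.1 ⟹ Conj. 1.2)] -/
theorem pastenWeakABC_of_polySzpiroRat (hAPS : Summit.ABC.PolySzpiroRat) : PastenWeakABC := by
  obtain ⟨K, C, hKC⟩ := hAPS
  set K' : ℝ := max K 0 with hK'
  have hK'0 : 0 ≤ K' := le_max_right _ _
  set B : ℝ := 2 * Real.exp C * (2 : ℝ) ^ (8 * K') with hB
  have hBpos : 0 < B := by positivity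
  set L : ℝ := max 1 (Real.logb 2 B + 1) with hL
  have hL1 : 1 ≤ L := le_max_left _ _
  refine ⟨K' + L, by linarith, ?_⟩
  intro a b c h
  haveI := h.freyCurve_isElliptic
  set E : WeierstrassCurve ℚ := freyCurve (a : ℤ) (b : ℤ) with hE
  have hDpos : 0 < E.minimalDiscriminantNorm ℤ := WeierstrassCurve.minimalDiscriminantNorm_pos_holds _
  have hNpos : 0 < E.conductorNorm ℤ := E.conductorNorm_pos_holds
  have hNle : ((E.conductorNorm ℤ : ℕ) : ℝ) ≤ 2 ^ 8 * (rad a b c : ℝ) := h.conductorNorm_freyCurve_le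
  have hrad2 : (2 : ℝ) ≤ (rad a b c : ℝ) := by exact_mod_cast h.two_le_rad
  have hradpos : (0 : ℝ) < (rad a b c : ℝ) := by linarith
  -- (1) `abc ≤ 2 Δ_min`
  have habcD : a * b * c ≤ 2 * E.minimalDiscriminantNorm ℤ := by
    obtain ⟨n, hn, hodd, hle⟩ := exists_odd_dvd_le h
    have := Nat.le_of_dvd hDpos (sq_dvd_minimalDiscriminantNorm_freyCurve h hn hodd)
    omega
  -- (2) `log Δ_min ≤ K' (8 log 2 + log rad) + C`
  have hDR : (0 : ℝ) < (E.minimalDiscriminantNorm ℤ : ℝ) := by exact_mod_cast hDpos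
  have hNR : (0 : ℝ) < (E.conductorNorm ℤ : ℝ) := by exact_mod_cast hNpos
  have hlogN0 : 0 ≤ Real.log (E.conductorNorm ℤ : ℝ) :=
    Real.log_nonneg (by exact_mod_cast hNpos)
  have hlogN : Real.log (E.conductorNorm ℤ : ℝ) ≤ 8 * Real.log 2 + Real.log (rad a b c : ℝ) := by
    have := Real.log_le_log hNR hNle
    rw [Real.log_mul (by positivity) hradpos.ne', Real.log_pow] at this
    exact_mod_cast this
  have hlogD : Real.log (E.minimalDiscriminantNorm ℤ : ℝ) ≤
      K' * (8 * Real.log 2 + Real.log (rad a b c : ℝ)) + C := by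
    have h1 := hKC E
    have h2 : K * Real.log (E.conductorNorm ℤ : ℝ) ≤ K' * Real.log (E.conductorNorm ℤ : ℝ) :=
      mul_le_mul_of_nonneg_right (le_max_left K 0) hlogN0
    have h3 : K' * Real.log (E.conductorNorm ℤ : ℝ) ≤
        K' * (8 * Real.log 2 + Real.log (rad a b c : ℝ)) := mul_le_mul_of_nonneg_left hlogN hK'0
    linarith
  -- (3) exponentiate: `Δ_min ≤ e^C · 2^{8K'} · rad^{K'}`
  have hDle : (E.minimalDiscriminantNorm ℤ : ℝ) ≤
      Real.exp C * (2 : ℝ) ^ (8 * K') * (rad a b c : ℝ) ^ K' := by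
    have := Real.exp_le_exp.mpr hlogD
    rw [Real.exp_log hDR] at this
    refine this.trans (le_of_eq ?_)
    rw [Real.rpow_def_of_pos (by norm_num : (0:ℝ) < 2), Real.rpow_def_of_pos hradpos,
      ← Real.exp_add, ← Real.exp_add]
    congr 1; ring
  -- (4) assemble
  have habcR : ((a * b * c : ℕ) : ℝ) ≤ B * (rad a b c : ℝ) ^ K' := by
    have h1 : ((a * b * c : ℕ) : ℝ) ≤ 2 * (E.minimalDiscriminantNorm ℤ : ℝ) := by
      exact_mod_cast habcD
    rw [hB]
    nlinarith [hDle, Real.rpow_nonneg hradpos.le K']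
  have hBlt : B < (rad a b c : ℝ) ^ L := by
    have h1 : B = (2 : ℝ) ^ Real.logb 2 B := (Real.rpow_logb (by norm_num) (by norm_num) hBpos).symm
    have h2 : (2 : ℝ) ^ Real.logb 2 B < (2 : ℝ) ^ L :=
      Real.rpow_lt_rpow_of_exponent_lt (by norm_num) (by
        have := le_max_right 1 (Real.logb 2 B + 1); linarith)
    have h3 : (2 : ℝ) ^ L ≤ (rad a b c : ℝ) ^ L :=
      Real.rpow_le_rpow (by norm_num) hrad2 (by linarith)
    linarith
  have hK'pos : 0 < (rad a b c : ℝ) ^ K' := Real.rpow_pos_of_pos hradpos K'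
  calc ((a * b * c : ℕ) : ℝ) ≤ B * (rad a b c : ℝ) ^ K' := habcR
    _ < (rad a b c : ℝ) ^ L * (rad a b c : ℝ) ^ K' := mul_lt_mul_of_pos_right hBlt hK'pos
    _ = ((rad a b c : ℕ) : ℝ) ^ (K' + L) := by rw [Real.rpow_add hradpos]; ring


end Summit.ABC.Harvest
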